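import Literature.MathematicalPhysics.QuantumFieldTheory.Balaban1983to89.B8Eq198CubeMemberOfReal12
import Literature.MathematicalPhysics.QuantumFieldTheory.Balaban1983to89.B8Eq1101CubeMemberParametrixIdentity

/-!
# `Balaban1983to89.B8Eq348CubeMemberFlatMatrixNorm` — [Balaban1985RegularSpaces] ∕ [Balaban1985BackgroundPropagators] (3.48): the `ℓ²` NORM BOUND of the consumer's
# flat matrix on the cube member, `‖Tv‖² ≤ ((4(d+1) + a_max)η⁻²)²‖v‖²` (Schur test), hence — with F11 — the unconditional `ℓ²` gap of `QT⁻²Qᵀ` (third brick of the 𝒢-bound programme)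

statement-level skeleton of published theorems with citation tags; proofs where landed; nothing here is a claim about the
Yang–Mills mass gap

`[Balaban1985RegularSpaces]` ("B8") (1.91) p. 91, (1.31) p. 81; `[Balaban1985BackgroundPropagators]` ("[4]") Theorem 3.2 (3.48) p. 398; `[Balaban1984PropagatorsII]`
("[B6]") (2.13)–(2.14) p. 225, Lemma 2.1 (2.61)–(2.62) p. 234 (the row-sum ∕ Schur-type bounds).

CITATION HEADER (lean-in-tree rule).  Cell `pub-ymgap` (YM Track A, HUMAN RULING D-0062), DAG node N05 = [B8], seat `pub-ymgap-dag-n05-c` (g9; (R1′) programme, file F12).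
F11 (`B8Eq348CubeMemberTowerGramCoercive.towerGram_coercive_of_normBound`) reduced the `ℓ²` gap of the tower Gram matrix `M = QT⁻²Qᵀ` (input of the Combes–Thomas
step on the wall towers in the 𝒢-bound programme, `HOME/pub-ymgap-dag-n05-c/R23-DESIGN.md`) to a norm bound `‖Tv‖² ≤ C_T²‖v‖²`.  THIS FILE proves that bound with
`C_T = (4(d+1) + a_max)η⁻²` by the Schur test: `K` is symmetric (n05-e `flatKernel_symm`) and its absolute row sums are `≤ (4(d+1) + a_max)η⁻²` (the stencil gives
`4(d+1)η⁻²`; the ONE tower through a site, of level `J` with `(L^{d+1})^J` sites, gives `w_J L^{−(d+1)J} = a′_Jη⁻²L^{−2J} ≤ a_maxη⁻²`).  The combination with F11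
(`Σ_p L^{−(d+1)j_p}X_p² ≤ ((4(d+1) + a_max)η⁻²)²·⟨X, MX⟩`) is one `exact` once both modules are built; it is not restated here.

WHAT THIS FILE PROVES (kernel-checked; theorems only).
* §1 `sq_sum_mul_le` (weighted Cauchy–Schwarz `(Σ a u)² ≤ (Σ a)(Σ a u²)`, `a ≥ 0`), ★ `schur_sq_sum_le` (symmetric kernel on a finite set, absolute row sums `≤ R`
  ⟹ `Σ_x(Σ_z K(x,z)v(z))² ≤ R²Σ_z v(z)²`) — generic.
* §2 ★ `flatKernel_rowAbs_le` — `Σ_{z∈□₀}|K(x,z)| ≤ (4(d+1) + a_max)η⁻²` for `x ∈ □₀` (consumer's verbatim `K`, any `L ≥ 1`, weights with normalised size `≤ a_max`).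
* §3 ★★ `flatMatrix_normBound` — `Σ_x ((T *ᵥ v) x)² ≤ ((4(d+1) + a_max)η⁻²)²·Σ_x (v x)²` for every `v : ↥S → ℝ` — EXACTLY the hypothesis `hTn` of F11.

HONEST SCOPE ∕ NOT CLAIMED.  An `ℓ²` operator-norm bound only; the 𝒢-bound (`B8Thm32GBoundCubeMember.GBoundCubeMemberPrinted`) stays OPEN.  Count-neutral; N05 NOT
discharged; one finite `T⁴` programme at fixed `ε`, Bałaban as printed; nothing continuum ∕ ℝ⁴ ∕ OS ∕ mass-gap ∕ Clay.  No `sorry`, no `def`, no `instance`, no `notation`.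
Unit `pub-ymgap-dag-n05-c` (g9), 2026-08-27.

RELATED IN THE TREE, NOT DUPLICATED: `B8Eq1101CubeMemberParametrixIdentity.abs_row_le` (F4b, USED: a row of `|K|` against a nonnegative function),
`B8Eq198CubeMemberOfReal12.card_filter_block_le` (F5, USED), `B8Eq191FlatTowerGram.flatKernel_symm` (n05-e, USED), `B8Eq191FlatDirichletConjugation.
{coshDefect_le_of_rowBound, rowBound_flatDirichlet}` (g8: the WEIGHTED Schur test for the Combes–Thomas conjugation — a different estimate on the same rows),
`B8Eq348CubeMemberTowerGramCoercive.towerGram_coercive_of_normBound` (F11, the consumer of §3).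
-/
noncomputable section

namespace Literature.MathematicalPhysics.QuantumFieldTheory.Balaban1983to89.B8Eq348CubeMemberFlatMatrixNorm

open scoped Matrix
open B7Prop1Explicit (e)
open B8Eq131CubesAdmissible (cubeFam)
open B8CubeMemberZd (cubeLamS)
open B8LambdaSpaceKLevel (wt)
open B8Eq191FlatTowerGram (flatKernel_symm)
open B8Eq191FlatLettersCubeMember (towers_disjoint_cube)
open B8Eq191FlatDirichletCoercive (towerBlock_subset_cube)
open B8Eq191FlatDirichletConjugation (cover_cubeMember)
open B8Eq198CubeMemberOfReal12 (card_filter_block_le)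
open B8Eq1101CubeMemberParametrixIdentity (abs_row_le)
open Literature.MathematicalPhysics.QuantumLattice (blockMap)

variable {d : ℕ}

/-! ## §1 The Schur test (symmetric kernel, absolute row sums `≤ R` ⇒ `‖Kv‖² ≤ R²‖v‖²`) -/

/-- Weighted Jensen ∕ Cauchy–Schwarz: for weights `a ≥ 0`, `(Σ a_z u_z)² ≤ (Σ a_z)·(Σ a_z u_z²)`. [folklore]
[cite: Balaban1984PropagatorsII, Lemma 2.1 (2.61) p.234] -/
theorem sq_sum_mul_le {α : Type*} (S : Finset α) (a u : α → ℝ) (ha : ∀ z ∈ S, 0 ≤ a z) :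
    (∑ z ∈ S, a z * u z) ^ 2 ≤ (∑ z ∈ S, a z) * ∑ z ∈ S, a z * u z ^ 2 := by
  have hf : ∀ z ∈ S, Real.sqrt (a z) * (Real.sqrt (a z) * u z) = a z * u z := fun z hz => by
    rw [← mul_assoc, Real.mul_self_sqrt (ha z hz)]
  have h := Finset.sum_mul_sq_le_sq_mul_sq S (fun z => Real.sqrt (a z)) (fun z => Real.sqrt (a z) * u z)
  rw [Finset.sum_congr rfl hf] at h
  refine h.trans (le_of_eq ?_)
  congr 1
  · exact Finset.sum_congr rfl fun z hz => by rw [Real.sq_sqrt (ha z hz)]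
  · exact Finset.sum_congr rfl fun z hz => by rw [mul_pow, Real.sq_sqrt (ha z hz)]

/-- **THE SCHUR TEST** for a symmetric kernel on a finite set: absolute row sums `≤ R` ⇒ `Σ_x(Σ_z K(x,z)v(z))² ≤ R²·Σ_z v(z)²`. [folklore]
[cite: Balaban1984PropagatorsII, Lemma 2.1 (2.61)–(2.62) p.234] -/
theorem schur_sq_sum_le {α : Type*} (S : Finset α) (K : α → α → ℝ) (hsymm : ∀ x ∈ S, ∀ z ∈ S, K x z = K z x) {R : ℝ} (hR : 0 ≤ R)
    (hrow : ∀ x ∈ S, ∑ z ∈ S, |K x z| ≤ R) (v : α → ℝ) :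
    ∑ x ∈ S, (∑ z ∈ S, K x z * v z) ^ 2 ≤ R ^ 2 * ∑ z ∈ S, v z ^ 2 := by
  -- pointwise: `(Σ_z K v)² ≤ R·Σ_z |K(x,z)| v_z²`
  have hpt : ∀ x ∈ S, (∑ z ∈ S, K x z * v z) ^ 2 ≤ R * ∑ z ∈ S, |K x z| * v z ^ 2 := by
    intro x hx
    obtain ⟨u, hu⟩ : ∃ u : α → ℝ, ∀ z, u z = if 0 ≤ K x z then v z else -v z := ⟨_, fun _ => rfl⟩
    have hKu : ∀ z, K x z * v z = |K x z| * u z := by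
      intro z; rw [hu]
      split_ifs with h
      · rw [abs_of_nonneg h]
      · rw [abs_of_neg (lt_of_not_ge h)]; ring
    have hu2 : ∀ z, u z ^ 2 = v z ^ 2 := by intro z; rw [hu]; split_ifs <;> ring
    rw [Finset.sum_congr rfl (fun z _ => hKu z)]
    calc (∑ z ∈ S, |K x z| * u z) ^ 2 ≤ (∑ z ∈ S, |K x z|) * ∑ z ∈ S, |K x z| * u z ^ 2 :=
          sq_sum_mul_le S (fun z => |K x z|) u (fun z _ => abs_nonneg _)
      _ ≤ R * ∑ z ∈ S, |K x z| * v z ^ 2 := by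
          rw [Finset.sum_congr rfl (fun z _ => by rw [hu2 z] : ∀ z ∈ S, |K x z| * u z ^ 2 = |K x z| * v z ^ 2)]
          exact mul_le_mul_of_nonneg_right (hrow x hx) (Finset.sum_nonneg fun z _ => mul_nonneg (abs_nonneg _) (sq_nonneg _))
  -- sum over `x`, swap, use the symmetric row bound
  calc ∑ x ∈ S, (∑ z ∈ S, K x z * v z) ^ 2 ≤ ∑ x ∈ S, R * ∑ z ∈ S, |K x z| * v z ^ 2 := Finset.sum_le_sum hpt
    _ = R * ∑ z ∈ S, (∑ x ∈ S, |K z x|) * v z ^ 2 := by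
        rw [← Finset.mul_sum, Finset.sum_comm]
        congr 1
        refine Finset.sum_congr rfl fun z hz => ?_
        rw [Finset.sum_mul]
        exact Finset.sum_congr rfl fun x hx => by rw [hsymm x hx z hz]
    _ ≤ R * ∑ z ∈ S, R * v z ^ 2 := by
        refine mul_le_mul_of_nonneg_left (Finset.sum_le_sum fun z hz => ?_) hR
        exact mul_le_mul_of_nonneg_right (hrow z hz) (sq_nonneg _)
    _ = R ^ 2 * ∑ z ∈ S, v z ^ 2 := by rw [← Finset.mul_sum]; ring

/-! ## §2 The absolute row sums of the consumer's kernel: `Σ_z |K(x,z)| ≤ (4(d+1) + a_max)η⁻²` -/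

open Classical in
/-- **ROW SUMS OF `|K|`** on the cube member: for `x ∈ □₀`, `Σ_{z∈□₀}|K(x,z)| ≤ (4(d+1) + a_max)·η⁻²` — the Laplacian stencil contributes `4(d+1)η⁻²`, the tower
through `x` (level `J`, `(L^{d+1})^J` sites) contributes `w_J L^{−(d+1)J} = a′_J η⁻² L^{−2J} ≤ a_max η⁻²`.
[cite: Balaban1985RegularSpaces, (1.91) p.91, (1.31) p.81; Balaban1984PropagatorsII, (2.13)–(2.14) p.225] -/
theorem flatKernel_rowAbs_le {L : ℕ} (hL : 1 ≤ L) (a : Fin (d + 1) → ℤ) (M : ℕ) {ρ : ℕ} (hρ : L ≤ ρ) {k n : ℕ} (hn : n ≤ k)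
    {η : ℝ} (hη : η ≠ 0) (w : ℕ → ℝ) (hw0 : ∀ j, 0 ≤ w j) {amax : ℝ} (hamax0 : 0 ≤ amax)
    (hamax : ∀ j, j ≤ n → w j * η ^ 2 * ((L : ℝ) ^ j) ^ 2 * ((((L : ℝ) ^ (d + 1)) ^ j))⁻¹ ≤ amax)
    (S : Finset (Fin (d + 1) → ℤ)) (hS : ∀ x, x ∈ S ↔ x ∈ cubeFam false L a M ρ k 0)
    (K : (Fin (d + 1) → ℤ) → (Fin (d + 1) → ℤ) → ℝ)
    (hK : ∀ x z, K x z = ((η ^ 2)⁻¹ * ∑ μ : Fin (d + 1), ((2 : ℝ) * (if z = x then (1 : ℝ) else 0) - (if z = x + e μ then (1 : ℝ) else 0)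
        - (if z = x - e μ then (1 : ℝ) else 0))) +
        (∑ j ∈ Finset.range (n + 1), (if blockMap (L ^ j) x ∈ cubeLamS L a M ρ k n j ∧ blockMap (L ^ j) z = blockMap (L ^ j) x then
          w j * ((((L : ℝ) ^ (d + 1))⁻¹) ^ j) ^ 2 else 0)))
    {x : Fin (d + 1) → ℤ} (hx : x ∈ S) :
    ∑ z ∈ S, |K x z| ≤ (4 * ((d : ℝ) + 1) + amax) * (η ^ 2)⁻¹ := by
  have hL0 : (0 : ℝ) < L := by exact_mod_cast hL
  have hL1 : (1 : ℝ) ≤ L := by exact_mod_cast hL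
  have hη2 : 0 < η ^ 2 := by positivity
  have hx0 : x ∈ cubeFam false L a M ρ k 0 := (hS x).mp hx
  -- `abs_row_le` against the constant function `1`
  have hrow := abs_row_le L n (cubeLamS L a M ρ k n) w hw0 K hK S x (fun _ => (1 : ℝ)) (fun _ => zero_le_one)
  simp only [mul_one] at hrow
  -- the stencil part: `Σ_μ (2 + 1 + 1) = 4(d+1)`
  have hsten : (η ^ 2)⁻¹ * ∑ μ : Fin (d + 1), ((2 : ℝ) + 1 + 1) = 4 * ((d : ℝ) + 1) * (η ^ 2)⁻¹ := by
    rw [Finset.sum_const, Finset.card_univ, Fintype.card_fin, nsmul_eq_mul]; push_cast; ring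
  -- the tower part collapses to the level `J` of `x` and is `≤ a_max η⁻²`
  obtain ⟨J, hJn, hxJ⟩ := cover_cubeMember hL a M hρ hn x hx0
  have hcollapse : ∑ j' ∈ Finset.range (n + 1), (if blockMap (L ^ j') x ∈ cubeLamS L a M ρ k n j' then
        w j' * ((((L : ℝ) ^ (d + 1))⁻¹) ^ j') ^ 2 * ∑ z ∈ S.filter (fun z => blockMap (L ^ j') z = blockMap (L ^ j') x), (1 : ℝ) else 0)
      ≤ amax * (η ^ 2)⁻¹ := by
    have h : ∀ j' ∈ Finset.range (n + 1), (if blockMap (L ^ j') x ∈ cubeLamS L a M ρ k n j' then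
        w j' * ((((L : ℝ) ^ (d + 1))⁻¹) ^ j') ^ 2 * ∑ z ∈ S.filter (fun z => blockMap (L ^ j') z = blockMap (L ^ j') x), (1 : ℝ) else 0)
        = if J = j' then w J * ((((L : ℝ) ^ (d + 1))⁻¹) ^ J) ^ 2 *
            ∑ z ∈ S.filter (fun z => blockMap (L ^ J) z = blockMap (L ^ J) x), (1 : ℝ) else 0 := by
      intro j' hj'
      have hj'n : j' ≤ n := Nat.lt_succ_iff.mp (Finset.mem_range.mp hj')
      by_cases hc : blockMap (L ^ j') x ∈ cubeLamS L a M ρ k n j'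
      · have hjj : j' = J := (towers_disjoint_cube hL a M hρ hn j' hj'n J hJn _ hc _ hxJ x hx0 rfl rfl).1
        subst hjj; rw [if_pos hc, if_pos rfl]
      · have hne : J ≠ j' := fun h' => by subst h'; exact hc hxJ
        rw [if_neg hc, if_neg hne]
    rw [Finset.sum_congr rfl h, Finset.sum_ite_eq, if_pos (Finset.mem_range.mpr (Nat.lt_succ_of_le hJn))]
    -- the block has `≤ (L^{d+1})^J` sites
    have hfull : ∀ z, blockMap (L ^ J) z = blockMap (L ^ J) x → z ∈ S := fun z hz =>
      (hS z).mpr (towerBlock_subset_cube hL a M hρ hn hJn hxJ hz)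
    have hcard := card_filter_block_le hL J S x hfull
    rw [Finset.sum_const, nsmul_eq_mul, mul_one]
    have hwJ := hamax J hJn
    have hLJ : (1 : ℝ) ≤ ((L : ℝ) ^ J) ^ 2 := one_le_pow₀ (one_le_pow₀ hL1)
    have hpow : 0 < ((L : ℝ) ^ (d + 1)) ^ J := by positivity
    -- `w_J c_J² · card ≤ w_J c_J = (w_J η² L^{2J} c_J) · η⁻² L^{−2J} ≤ a_max η⁻²`
    calc w J * ((((L : ℝ) ^ (d + 1))⁻¹) ^ J) ^ 2 * ((S.filter (fun z => blockMap (L ^ J) z = blockMap (L ^ J) x)).card : ℝ)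
        ≤ w J * ((((L : ℝ) ^ (d + 1))⁻¹) ^ J) ^ 2 * ((L : ℝ) ^ (d + 1)) ^ J :=
          mul_le_mul_of_nonneg_left hcard (by have := hw0 J; positivity)
      _ = (w J * η ^ 2 * ((L : ℝ) ^ J) ^ 2 * ((((L : ℝ) ^ (d + 1)) ^ J))⁻¹) * ((η ^ 2)⁻¹ * (((L : ℝ) ^ J) ^ 2)⁻¹) := by
          rw [inv_pow]; field_simp
      _ ≤ amax * ((η ^ 2)⁻¹ * (((L : ℝ) ^ J) ^ 2)⁻¹) := mul_le_mul_of_nonneg_right hwJ (by positivity)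
      _ ≤ amax * ((η ^ 2)⁻¹ * 1) := by
          refine mul_le_mul_of_nonneg_left (mul_le_mul_of_nonneg_left ?_ (by positivity)) hamax0
          exact inv_le_one_of_one_le₀ hLJ
      _ = amax * (η ^ 2)⁻¹ := by rw [mul_one]
  calc ∑ z ∈ S, |K x z| ≤ _ := hrow
    _ ≤ 4 * ((d : ℝ) + 1) * (η ^ 2)⁻¹ + amax * (η ^ 2)⁻¹ := by rw [← hsten]; exact add_le_add le_rfl hcollapse
    _ = (4 * ((d : ℝ) + 1) + amax) * (η ^ 2)⁻¹ := by ring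

/-! ## §3 The norm bound `‖Tv‖² ≤ C_T²‖v‖²`, `C_T = (4(d+1) + a_max)η⁻²` -/

open Classical in
/-- **THE `ℓ²` NORM BOUND FOR THE CONSUMER'S FLAT MATRIX**: `Σ_x (Tv)_x² ≤ ((4(d+1) + a_max)η⁻²)²·Σ_x v_x²` for every `v` on `□₀` (Schur test: `K` is symmetric with
absolute row sums `≤ (4(d+1) + a_max)η⁻²`).  With `B8Eq348CubeMemberTowerGramCoercive.towerGram_coercive_of_normBound` this gives the unconditional `ℓ²` gap
`Σ_p L^{−(d+1)j_p}X_p² ≤ ((4(d+1) + a_max)η⁻²)²·⟨X, (QT⁻¹T⁻¹Qᵀ)X⟩` of the tower Gram matrix.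
[cite: Balaban1985RegularSpaces, (1.91) p.91; Balaban1985BackgroundPropagators, (3.48) p.398; Balaban1984PropagatorsII, Lemma 2.1 (2.61) p.234] -/
theorem flatMatrix_normBound {L : ℕ} (hL : 1 ≤ L) (a : Fin (d + 1) → ℤ) (M : ℕ) {ρ : ℕ} (hρ : L ≤ ρ) {k n : ℕ} (hn : n ≤ k)
    {η : ℝ} (hη : η ≠ 0) (w : ℕ → ℝ) (hw0 : ∀ j, 0 ≤ w j) {amax : ℝ} (hamax0 : 0 ≤ amax)
    (hamax : ∀ j, j ≤ n → w j * η ^ 2 * ((L : ℝ) ^ j) ^ 2 * ((((L : ℝ) ^ (d + 1)) ^ j))⁻¹ ≤ amax)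
    (S : Finset (Fin (d + 1) → ℤ)) (hS : ∀ x, x ∈ S ↔ x ∈ cubeFam false L a M ρ k 0)
    (K : (Fin (d + 1) → ℤ) → (Fin (d + 1) → ℤ) → ℝ)
    (hK : ∀ x z, K x z = ((η ^ 2)⁻¹ * ∑ μ : Fin (d + 1), ((2 : ℝ) * (if z = x then (1 : ℝ) else 0) - (if z = x + e μ then (1 : ℝ) else 0)
        - (if z = x - e μ then (1 : ℝ) else 0))) +
        (∑ j ∈ Finset.range (n + 1), (if blockMap (L ^ j) x ∈ cubeLamS L a M ρ k n j ∧ blockMap (L ^ j) z = blockMap (L ^ j) x then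
          w j * ((((L : ℝ) ^ (d + 1))⁻¹) ^ j) ^ 2 else 0)))
    (T : Matrix ↥S ↥S ℝ) (hT : T = Matrix.of (fun x z : ↥S => K x.1 z.1)) (v : ↥S → ℝ) :
    ∑ x, ((T *ᵥ v) x) ^ 2 ≤ ((4 * ((d : ℝ) + 1) + amax) * (η ^ 2)⁻¹) ^ 2 * ∑ x, (v x) ^ 2 := by
  -- the zero extension of `v`
  obtain ⟨vf, hvfS, hvf0⟩ : ∃ f : (Fin (d + 1) → ℤ) → ℝ, (∀ u : ↥S, f u.1 = v u) ∧ (∀ x, x ∉ S → f x = 0) :=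
    ⟨fun x => if h : x ∈ S then v ⟨x, h⟩ else 0, fun u => by simp [u.2], fun x hx => by simp [hx]⟩
  have hrowv : ∀ x : ↥S, (T *ᵥ v) x = ∑ z ∈ S, K x.1 z * vf z := by
    intro x
    rw [Matrix.mulVec, dotProduct, ← Finset.sum_coe_sort S]
    refine Finset.sum_congr rfl fun z _ => ?_
    rw [hT, Matrix.of_apply, hvfS z]
  have hlhs : ∑ x, ((T *ᵥ v) x) ^ 2 = ∑ x ∈ S, (∑ z ∈ S, K x z * vf z) ^ 2 := by
    rw [← Finset.sum_coe_sort S]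
    exact Finset.sum_congr rfl fun x _ => by rw [hrowv x]
  have hrhs : ∑ x, (v x) ^ 2 = ∑ x ∈ S, vf x ^ 2 := by
    rw [← Finset.sum_coe_sort S]
    exact Finset.sum_congr rfl fun x _ => by rw [hvfS x]
  rw [hlhs, hrhs]
  refine schur_sq_sum_le S K (fun x _ z _ => flatKernel_symm L n (cubeLamS L a M ρ k n) w K hK x z) (by positivity)
    (fun x hx => flatKernel_rowAbs_le hL a M hρ hn hη w hw0 hamax0 hamax S hS K hK hx) vf

end Literature.MathematicalPhysics.QuantumFieldTheory.Balaban1983to89.B8Eq348CubeMemberFlatMatrixNorm
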